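import Literature.AlgebraicGeometry.Resolution.HironakaDirectrixIdeal
import Literature.AlgebraicGeometry.Resolution.DiffStableAdjoin
import Literature.AlgebraicGeometry.Resolution.PlaneNearForms
import Summits.ResolutionOfSingularities.ResolutionOfSingularities.Theorems.MarkedTransferCampaignW46TamePolar
import HarnessLib

/-!
# [OURS · L1 W4.6, rung (iv) support] The CJS directrix space of a hypersurface cone is Hironaka's directrix of the
# form: `𝒯((h)) = T({h})`, hence `e = d − τ(h)` — every characteristic; in tame degree `e = d − rank(polar)`
# (cell res-hironaka, LADDER-RESOLUTION rung L, D-0089; slot W4.6, seat res-L1-s46-pv-7; host route MarkedTransfer,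
# `--supports stmt-ResolutionOfSingularities-16155 --as helper`)

HONEST FRAMING. Nothing here is a statement of H. Hironaka's manuscript (2017-03-23, [Hironaka2017]) and nothing here
asserts that any statement of it holds. Linear/commutative algebra over the TREE: CJS's directrix space
`Literature.RingTheory.MvPolynomial.directrixSpace I = 𝒯(I)` / `directrixDim I = e(S/I)` (`Directrix.lean`, CJS Lemma 2.7
/ Def. 2.8), Hironaka's `Resolution.directrix k S = T(S)` / `hironakaTau` (`HironakaDirectrix.lean`), the bridge
`HironakaDirectrixIdeal.lean` (`𝒯(I) ⊆ T(S)` for every generating set, `𝒯(I) = T(S)` for SOME generating set), and this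
seat's `TamePolar` (p481074). No premise of the manuscript, no FACT-LIST premise. AI review is weaker than expert review.
No `sorry`, no definition; axioms standard.

## What is proved

* `homogeneousComponent_mul_of_isHomogeneous_self` — for a form `h` of degree `b`: `(q · h)_b = q(0) · h`.
* `mem_linearFormsSubalgebra_of_directs_span_singleton` — if a space of linear forms `k[T']` DIRECTS the principal
  ideal `(h)` of a nonzero form (i.e. `(h)` is generated by elements of `k[T']`), then `h ∈ k[T']` itself (graded
  bookkeeping: some generator has degree-`b` component `c · h` with `c ≠ 0`, and `k[T']` is a graded subalgebra —
  tree `IsGradedSubalgebra.adjoin`).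
* `directrixSpace_span_singleton_eq_map_directrix` — **`𝒯((h)) = T({h})`** (as subspaces of `S_1`, through the tree's
  encoding `linearFormPolyₗ`) for every nonzero form `h`, in EVERY characteristic: for a principal homogeneous ideal the
  infimum in the tree's `exists_span_eq_and_directrixSpace_eq` is attained at the generator itself.
* `finrank_directrixSpace_span_singleton` (`dim 𝒯((h)) = τ({h})`) and `directrixDim_span_singleton`
  (`e((h)) = d − τ({h})`).
* Tame degree (`1, …, deg h` non-zero in `k`): `directrixDim_span_singleton_eq_sub_finrank_span_pderiv` —
  `e((h)) = d − dim_k ⟨∂h/∂Y_1, …, ∂h/∂Y_d⟩`, the CJS dimension of the directrix of a tame hypersurface cone is read off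
  the first partials (`TamePolar.hironakaTau_singleton_eq_finrank_span_pderiv`); `…_of_lt_char` for `p > deg h`.

## References (context; nothing is cited as a premise)

* Cossart–Jannsen–Saito 2020 (LNM 2270), Lemma 2.7, Def. 2.8. [cite: CossartJannsenSaito2020, Lemma 2.7 and Def. 2.8]
* Cossart–Piltant 2008, proof of Prop. 4.2 (`T(S)`, `τ`). [cite: CossartPiltant2008, proof of Prop. 4.2]
-/

noncomputable section

set_option linter.dupNamespace false -- mandated namespace of this single-conjunct summit

namespace Summit.ResolutionOfSingularities.ResolutionOfSingularities.Theorems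
namespace CampaignW46
namespace PrincipalDirectrix

open MvPolynomial
open Literature.RingTheory.MvPolynomial
open Literature.AlgebraicGeometry.Resolution

universe u

variable {k : Type u} [Field k] {d : ℕ}

/-- **The degree-`b` component of a multiple of a form of degree `b`** is the constant term of the multiplier times the
form: `(q · h)_b = q(0) · h`. [folklore] -/
theorem homogeneousComponent_mul_of_isHomogeneous_self {h : MvPolynomial (Fin d) k} {b : ℕ} (hh : h.IsHomogeneous b)
    (q : MvPolynomial (Fin d) k) : homogeneousComponent b (q * h) = C (coeff 0 q) * h := by
  classical
  have hq : q * h = ∑ i ∈ Finset.range (q.totalDegree + 1), homogeneousComponent i q * h := by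
    rw [← Finset.sum_mul, sum_homogeneousComponent]
  rw [hq, map_sum, Finset.sum_eq_single 0]
  · rw [homogeneousComponent_zero, homogeneousComponent_of_mem
      ((mem_homogeneousSubmodule _ _).mpr ((isHomogeneous_C _ (coeff 0 q)).mul hh)), if_pos (zero_add b).symm]
  · intro i _ hi0
    rw [homogeneousComponent_of_mem
      ((mem_homogeneousSubmodule _ _).mpr ((homogeneousComponent_isHomogeneous i q).mul hh)), if_neg (by omega)]
  · intro h0
    exact absurd (Finset.mem_range.mpr (Nat.succ_pos _)) h0

/-- **A subalgebra of linear forms that directs the principal ideal of a nonzero form contains the form.** If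
`(h) = (S)` with `S ⊆ k[T']` (`T'` a space of linear forms), then `h ∈ k[T']`. [folklore] -/
theorem mem_linearFormsSubalgebra_of_span_eq {h : MvPolynomial (Fin d) k} {b : ℕ} (hh : h.IsHomogeneous b)
    (h0 : h ≠ 0) {T' : Submodule k (Module.Dual k (Fin d → k))} {S : Set (MvPolynomial (Fin d) k)}
    (hSU : S ⊆ linearFormsSubalgebra k T') (hSI : Ideal.span S = Ideal.span {h}) :
    h ∈ linearFormsSubalgebra k T' := by
  classical
  set U := linearFormsSubalgebra k T' with hU
  -- `U` is graded
  have hgr : IsGradedSubalgebra U := by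
    rw [hU, linearFormsSubalgebra]
    refine IsGradedSubalgebra.adjoin ?_
    rintro _ ⟨ℓ, _, rfl⟩
    exact ⟨1, isHomogeneous_linearFormPoly ℓ⟩
  -- `h = Σ_s c_s • s` with `s ∈ S`
  have hmem : h ∈ Ideal.span S := by rw [hSI]; exact Ideal.mem_span_singleton_self h
  obtain ⟨c, hcS, hsum⟩ := (Submodule.mem_span_set (R := MvPolynomial (Fin d) k)).mp hmem
  -- each `s` in the support is a multiple of `h`
  have hg : ∀ s ∈ c.support, ∃ g : MvPolynomial (Fin d) k, g * h = s := fun s hs =>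
    Ideal.mem_span_singleton'.mp (hSI ▸ Ideal.subset_span (hcS hs))
  choose! g hg using hg
  -- degree-`b` components: `h = (Σ_s (c s · g s)(0)) · h`
  have hcomp : h = C (∑ s ∈ c.support, coeff 0 (c s * g s)) * h := by
    conv_lhs => rw [← (homogeneousComponent_of_mem ((mem_homogeneousSubmodule _ _).mpr hh)).trans (if_pos rfl),
      ← hsum]
    rw [Finsupp.sum, map_sum, map_sum, Finset.sum_mul]
    refine Finset.sum_congr rfl fun s hs => ?_
    calc homogeneousComponent b (c s • s) = homogeneousComponent b ((c s * g s) * h) := by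
          rw [smul_eq_mul, mul_assoc, hg s hs]
      _ = C (coeff 0 (c s * g s)) * h := homogeneousComponent_mul_of_isHomogeneous_self hh _
  -- hence some `g s₀` has a nonzero constant term
  obtain ⟨s₀, hs₀, hc₀⟩ : ∃ s₀ ∈ c.support, coeff 0 (g s₀) ≠ 0 := by
    by_contra hall
    push Not at hall
    have hzero : (∑ s ∈ c.support, coeff 0 (c s * g s)) = 0 :=
      Finset.sum_eq_zero fun s hs => by
        rw [← constantCoeff_eq, RingHom.map_mul, constantCoeff_eq, hall s hs, mul_zero]
    rw [hzero, C_0, zero_mul] at hcomp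
    exact h0 hcomp
  -- `(s₀)_b = g(s₀)(0) · h ∈ U`, so `h ∈ U`
  have hs₀U : homogeneousComponent b (s₀ : MvPolynomial (Fin d) k) ∈ U := hgr _ (hSU (hcS hs₀)) b
  rw [← hg s₀ hs₀, homogeneousComponent_mul_of_isHomogeneous_self hh] at hs₀U
  have hinv : C (coeff 0 (g s₀))⁻¹ * (C (coeff 0 (g s₀)) * h) = h := by
    rw [← mul_assoc, ← map_mul, inv_mul_cancel₀ hc₀, C_1, one_mul]
  rw [← hinv]
  exact U.mul_mem (U.algebraMap_mem _) hs₀U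

/-- [OURS · L1 W4.6 support; NOT a statement of the manuscript] **`𝒯((h)) = T({h})` for a nonzero form `h`** (every
characteristic): the CJS directrix space of the principal homogeneous ideal `(h)` (tree `directrixSpace`, CJS Lemma 2.7)
is the image of Hironaka's directrix of `{h}` (tree `directrix`, encoded by `linearFormPolyₗ`). [folklore] -/
theorem directrixSpace_span_singleton_eq_map_directrix {h : MvPolynomial (Fin d) k} {b : ℕ} (hh : h.IsHomogeneous b)
    (h0 : h ≠ 0) :
    directrixSpace (Ideal.span {h}) = (directrix k ({h} : Set (MvPolynomial (Fin d) k))).map (linearFormPolyₗ k) := by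
  refine le_antisymm (directrixSpace_le_map_directrix rfl) ?_
  set I : Ideal (MvPolynomial (Fin d) k) := Ideal.span {h} with hI
  set T' := (directrixSpace I).comap (linearFormPolyₗ k) with hT'
  have hmap : T'.map (linearFormPolyₗ k) = directrixSpace I :=
    map_comap_linearFormPolyₗ k (directrixSpace_le_one I)
  have hdir : Directs I (T'.map (linearFormPolyₗ k)) := by
    rw [hmap]
    exact directs_directrixSpace I
  obtain ⟨S, hSU, hSI⟩ := directs_map_iff.mp hdir
  have hhU : h ∈ linearFormsSubalgebra k T' := mem_linearFormsSubalgebra_of_span_eq hh h0 hSU hSI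
  have hle : directrix k ({h} : Set (MvPolynomial (Fin d) k)) ≤ T' :=
    directrix_le_of_subset k (Set.singleton_subset_iff.mpr hhU)
  calc (directrix k ({h} : Set (MvPolynomial (Fin d) k))).map (linearFormPolyₗ k)
      ≤ T'.map (linearFormPolyₗ k) := Submodule.map_mono hle
    _ = directrixSpace I := hmap

/-- [OURS · L1 W4.6 support] **`dim_k 𝒯((h)) = τ({h})`** for a nonzero form `h` (every characteristic). [folklore] -/
theorem finrank_directrixSpace_span_singleton {h : MvPolynomial (Fin d) k} {b : ℕ} (hh : h.IsHomogeneous b)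
    (h0 : h ≠ 0) :
    Module.finrank k (directrixSpace (Ideal.span {h})) = hironakaTau k ({h} : Set (MvPolynomial (Fin d) k)) := by
  rw [directrixSpace_span_singleton_eq_map_directrix hh h0, finrank_map_directrix]

/-- [OURS · L1 W4.6 support; NOT a statement of the manuscript] **`e((h)) = d − τ({h})`**: the CJS dimension of the
directrix of the cone of a nonzero form (tree `directrixDim`, CJS Def. 2.8) is computed by Hironaka's `τ` of the form.
Every characteristic. [folklore] -/
theorem directrixDim_span_singleton {h : MvPolynomial (Fin d) k} {b : ℕ} (hh : h.IsHomogeneous b) (h0 : h ≠ 0) :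
    directrixDim (Ideal.span {h}) = d - hironakaTau k ({h} : Set (MvPolynomial (Fin d) k)) := by
  rw [directrixDim, finrank_directrixSpace_span_singleton hh h0]

/-- [OURS · L1 W4.6 (iv); NOT a statement of the manuscript] **Tame degree: `e((h)) = d − dim ⟨∂h/∂Y_i⟩`.** For a nonzero
form `h` with `1, …, deg h` non-zero in `k`, the CJS directrix dimension of the cone `h = 0` is `d` minus the rank of the
first partials (`TamePolar.hironakaTau_singleton_eq_finrank_span_pderiv`). [folklore] -/
theorem directrixDim_span_singleton_eq_sub_finrank_span_pderiv {h : MvPolynomial (Fin d) k} {b : ℕ}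
    (hh : h.IsHomogeneous b) (h0 : h ≠ 0) (hchar : ∀ m : ℕ, 1 ≤ m → m ≤ h.totalDegree → (m : k) ≠ 0) :
    directrixDim (Ideal.span {h}) =
      d - Module.finrank k (Submodule.span k (Set.range fun i : Fin d => pderiv i h)) := by
  rw [directrixDim_span_singleton hh h0, TamePolar.hironakaTau_singleton_eq_finrank_span_pderiv k h hchar]

/-- [OURS · L1 W4.6 (iv)] **Characteristic `p > deg h`** version. [folklore] -/
theorem directrixDim_span_singleton_eq_sub_finrank_span_pderiv_of_lt_char (p : ℕ) [CharP k p]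
    {h : MvPolynomial (Fin d) k} {b : ℕ} (hh : h.IsHomogeneous b) (h0 : h ≠ 0) (hp : h.totalDegree < p) :
    directrixDim (Ideal.span {h}) =
      d - Module.finrank k (Submodule.span k (Set.range fun i : Fin d => pderiv i h)) :=
  directrixDim_span_singleton_eq_sub_finrank_span_pderiv hh h0 (TamePolar.natCast_ne_zero_of_lt_char p hp)

end PrincipalDirectrix
end CampaignW46
end Summit.ResolutionOfSingularities.ResolutionOfSingularities.Theorems

end
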